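import Summits.QuantumFields.YangMills.Theorems.LuscherReductionTwistedTraceScalingBOCentralGaussian
import Summits.QuantumFields.YangMills.Theorems.LuscherReductionTwistedTraceScalingConstTubeOrtho
import Summits.QuantumFields.YangMills.Theorems.LuscherReductionOneSiteLevelsGnPullback
import HarnessLib

/-!
# (C1d-δ) THE CENTRAL GAUSSIAN AT A TUBE POINT: `orthoTube L 1 v' = P(gnLink ∘ chartSU2 ∘ v')`, the Lipschitz control of the stiff exponent `q`, and the chart ↔ tube conversion
# (lane A of S-BASE, crux `TwistedTraceScaling` stmt-QuantumFields-20203, C4-CORE, the (OD) pen, brick (C1d) of `pub/ym-fleet/ym-luscher-20007-p1/COARSE-DESIGN.md` §27.8–§27.9)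

`…BOCentralGaussian.central_gaussian_lower/upper` evaluate `∫ K_β(P(w'), V)·G(V) dμ(V)` around a CHART point `P(w')`.  The (OD) glue wants the centre `orthoTube L 1 v'` and the answer in
terms of `e^{−q(linkEmbed v')}`.  This file supplies the conversion:
* §1 a crude bound on the lattice curl, `‖d v‖² ≤ 96‖v‖²` (`norm_latCurl_sq_le`), hence the eigenvalues of `t·H` are `≤ 96t` and the coefficients of `q_{t,b}` are `≤ 96t + b`
  (`stiffGaussExp_coeff_le`);
* §2 ★ `abs_stiffGaussExp_sub_le` — `|q(x) − q(y)| ≤ (96t + b)·‖x − y‖·‖x + y‖` (Parseval in the eigenframe + Cauchy–Schwarz); ★ `stiffGaussExp_add_of_ker` — `q(x + k) = q(x)` for `(t·H)k = 0`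
  (the zero modes — pure gauges and constant modes — are invisible to `q`);
* §3 ★ `gnoPoint_gnLink` (`P(gn U) = U` on the open upper hemisphere), `latPatternChart_gnLink`, ★ `orthoTube_one_eq_latPatternChart` (`orthoTube L 1 v' = P(w')`, `w'_e = gn(chartSU2 v'_e) =
  v'_e/√(1−|v'_e|²)`), with the ball bound `Σ_a w'_e a² ≤ (4/3)Σ_a v'_e a²` and the distance bound `‖chartVec w' − linkEmbed v'‖ ≤ 2τ²‖linkEmbed v'‖` (`Σ_a v'_e a² ≤ τ² ≤ 1/4`);
* §4 ★★ `abs_stiffGaussExp_chart_sub_tube_le` — `|q(chartVec w') − q(linkEmbed v')| ≤ 6(96t+b)τ²R²` for `‖linkEmbed v'‖ ≤ R`.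
The tube-point version of the two-sided central Gaussian (centre `orthoTube L 1 v'`, answer `stiffGaussTop·e^{−q(linkEmbed v')}·e^{±294βτ²R²}`) is the next file.
HONEST FRAMING: chart bookkeeping for a stub of a child of the CONDITIONAL route R2b1; (C1c'), (C4), (C5), (B-ST) OPEN; C4-CORE OPEN; not infinite volume, not a gap, not Clay.
-/

set_option autoImplicit false

noncomputable section

open MeasureTheory Filter Topology Real
open scoped BigOperators RealInnerProductSpace
open Literature.MathematicalPhysics.QuantumFieldTheory
open Literature.MathematicalPhysics.QuantumLattice
open Literature.MathematicalPhysics.QuantumFieldTheory.Balaban1983to89.T4CubeChartGnomonic (gnoPoint)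

namespace Summit.QuantumFields.YangMills.Theorems.FemtoTransferGap.TwoLattice.ConstTube

open Summit.QuantumFields.YangMills.Theorems.FemtoTransferGap
open Summit.QuantumFields.YangMills.Theorems.FemtoTransferGap.TwoLattice
open Summit.QuantumFields.YangMills.Theorems.FemtoTransferGap.TwoLattice.Stiff
open Summit.QuantumFields.YangMills.Theorems.FemtoTransferGap.TwoLattice.GnChart

variable {L : ℕ} [NeZero L]

/-! ## §1 A crude bound on the lattice curl and on the coefficients of `q` -/

omit [NeZero L] in
/-- A direction-indexed non-negative family summed over the ordered pairs `i < j` (either coordinate) is at most six times its full sum (crude). [folklore] -/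
theorem sum_pairs_le_six_mul {g : Fin 3 → ℝ} (hg : ∀ k, 0 ≤ g k) (π₀ : Fin 3 × Fin 3 → Fin 3) (hπ : ∀ p, π₀ p = p.1 ∨ π₀ p = p.2) :
    ∑ ij : {p : Fin 3 × Fin 3 // p.1 < p.2}, g (π₀ ij.1) ≤ 6 * ∑ k, g k := by
  classical
  have h1 : ∑ ij : {p : Fin 3 × Fin 3 // p.1 < p.2}, g (π₀ ij.1) = ∑ p ∈ Finset.univ.filter (fun p : Fin 3 × Fin 3 => p.1 < p.2), g (π₀ p) :=
    (Finset.sum_subtype (Finset.univ.filter (fun p : Fin 3 × Fin 3 => p.1 < p.2)) (fun p => by simp) (fun p => g (π₀ p))).symm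
  have h2 : ∑ p ∈ Finset.univ.filter (fun p : Fin 3 × Fin 3 => p.1 < p.2), g (π₀ p) ≤ ∑ p : Fin 3 × Fin 3, g (π₀ p) :=
    Finset.sum_le_sum_of_subset_of_nonneg (Finset.filter_subset _ _) fun p _ _ => hg _
  have h3 : ∑ p : Fin 3 × Fin 3, g (π₀ p) ≤ ∑ p : Fin 3 × Fin 3, (g p.1 + g p.2) := Finset.sum_le_sum fun p _ => by
    rcases hπ p with h | h <;> rw [h] <;> linarith [hg p.1, hg p.2]
  have h4 : ∑ p : Fin 3 × Fin 3, (g p.1 + g p.2) = 3 * ∑ k, g k + 3 * ∑ k, g k := by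
    rw [Finset.sum_add_distrib, Fintype.sum_prod_type, Fintype.sum_prod_type]
    simp only [Finset.sum_const, Finset.card_univ, Fintype.card_fin, nsmul_eq_mul, Nat.cast_ofNat]
    rw [Finset.mul_sum]
  have h0 : 0 ≤ ∑ k, g k := Finset.sum_nonneg fun k _ => hg k
  linarith

/-- The link energy `Σ_x Σ_k Σ_a v((x,k),a)² = ‖v‖²`. [folklore] -/
theorem sum_site_dir_sq_eq_norm_sq (v : LinkSpace L) : ∑ x : Site 3 L, ∑ k : Fin 3, ∑ a : Fin 3, v ((x, k), a) ^ 2 = ‖v‖ ^ 2 := by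
  rw [EuclideanSpace.norm_sq_eq, Fintype.sum_prod_type, Fintype.sum_prod_type]
  simp only [Real.norm_eq_abs, sq_abs]

/-- ★ **Crude curl bound**: `‖d v‖² ≤ 96‖v‖²` (each plaquette term is a signed sum of four link entries; `(Σ₄)² ≤ 4Σ₄²`, and each of the four families of entries, summed over plaquettes and
colours, is at most `6‖v‖²`). [folklore] -/
theorem norm_latCurl_sq_le (v : LinkSpace L) : ‖latCurl L v‖ ^ 2 ≤ 96 * ‖v‖ ^ 2 := by
  classical
  rw [norm_latCurl_sq]
  -- the four families
  set A : Plaquette 3 L × Fin 3 → ℝ := fun q => v ((q.1.1, q.1.2.1.1), q.2) with hA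
  set B : Plaquette 3 L × Fin 3 → ℝ := fun q => v ((q.1.1.shift q.1.2.1.1, q.1.2.1.2), q.2) with hB
  set C : Plaquette 3 L × Fin 3 → ℝ := fun q => v ((q.1.1.shift q.1.2.1.2, q.1.2.1.1), q.2) with hC
  set D : Plaquette 3 L × Fin 3 → ℝ := fun q => v ((q.1.1, q.1.2.1.2), q.2) with hD
  have hpt : ∀ q : Plaquette 3 L × Fin 3, (latCurl L v q) ^ 2 ≤ 4 * (A q ^ 2 + B q ^ 2 + C q ^ 2 + D q ^ 2) := by
    rintro ⟨⟨x, ij⟩, a⟩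
    rw [latCurl_apply]
    simp only [hA, hB, hC, hD]
    nlinarith [sq_nonneg (v ((x, ij.1.1), a) - v ((x.shift ij.1.1, ij.1.2), a)), sq_nonneg (v ((x.shift ij.1.2, ij.1.1), a) - v ((x, ij.1.2), a)),
      sq_nonneg (v ((x, ij.1.1), a) + v ((x.shift ij.1.1, ij.1.2), a) + v ((x.shift ij.1.2, ij.1.1), a) + v ((x, ij.1.2), a)),
      sq_nonneg (v ((x, ij.1.1), a) + v ((x.shift ij.1.2, ij.1.1), a)), sq_nonneg (v ((x.shift ij.1.1, ij.1.2), a) + v ((x, ij.1.2), a)),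
      sq_nonneg (v ((x, ij.1.1), a) - v ((x, ij.1.2), a)), sq_nonneg (v ((x.shift ij.1.1, ij.1.2), a) - v ((x.shift ij.1.2, ij.1.1), a))]
  -- the per-site direction energies
  set g : Site 3 L → Fin 3 → ℝ := fun x k => ∑ a : Fin 3, v ((x, k), a) ^ 2 with hg
  have hg0 : ∀ x k, 0 ≤ g x k := fun x k => Finset.sum_nonneg fun a _ => sq_nonneg _
  have hnorm : ∑ x, ∑ k, g x k = ‖v‖ ^ 2 := by rw [hg]; exact sum_site_dir_sq_eq_norm_sq v
  -- each family is ≤ 3‖v‖²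
  have hfam : ∀ (σ : Fin 3 × Fin 3 → Site 3 L → Site 3 L) (π₀ : Fin 3 × Fin 3 → Fin 3), (∀ p, π₀ p = p.1 ∨ π₀ p = p.2) →
      (∀ p (F : Site 3 L → ℝ), ∑ x, F (σ p x) = ∑ x, F x) →
      ∑ q : Plaquette 3 L × Fin 3, v ((σ q.1.2.1 q.1.1, π₀ q.1.2.1), q.2) ^ 2 ≤ 6 * ‖v‖ ^ 2 := by
    intro σ π₀ hπ hσ
    have h1 : ∑ q : Plaquette 3 L × Fin 3, v ((σ q.1.2.1 q.1.1, π₀ q.1.2.1), q.2) ^ 2 =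
        ∑ ij : {p : Fin 3 × Fin 3 // p.1 < p.2}, ∑ x : Site 3 L, g (σ ij.1 x) (π₀ ij.1) := by
      rw [Fintype.sum_prod_type, Fintype.sum_prod_type, Finset.sum_comm]
    have h2 : ∀ ij : {p : Fin 3 × Fin 3 // p.1 < p.2}, ∑ x : Site 3 L, g (σ ij.1 x) (π₀ ij.1) = ∑ x : Site 3 L, g x (π₀ ij.1) := fun ij => hσ ij.1 (fun x => g x (π₀ ij.1))
    rw [h1, Finset.sum_congr rfl fun ij _ => h2 ij]
    have h3 := sum_pairs_le_six_mul (g := fun k => ∑ x : Site 3 L, g x k) (fun k => Finset.sum_nonneg fun x _ => hg0 x k) π₀ hπ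
    rw [Finset.sum_comm] at hnorm
    rw [hnorm] at h3
    exact h3
  have hAs : ∑ q, A q ^ 2 ≤ 6 * ‖v‖ ^ 2 := hfam (fun _ x => x) (fun p => p.1) (fun p => Or.inl rfl) (fun _ _ => rfl)
  have hBs : ∑ q, B q ^ 2 ≤ 6 * ‖v‖ ^ 2 := hfam (fun p x => x.shift p.1) (fun p => p.2) (fun p => Or.inr rfl) (fun p F => sum_shift_eq L F p.1)
  have hCs : ∑ q, C q ^ 2 ≤ 6 * ‖v‖ ^ 2 := hfam (fun p x => x.shift p.2) (fun p => p.1) (fun p => Or.inl rfl) (fun p F => sum_shift_eq L F p.2)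
  have hDs : ∑ q, D q ^ 2 ≤ 6 * ‖v‖ ^ 2 := hfam (fun _ x => x) (fun p => p.2) (fun p => Or.inr rfl) (fun _ _ => rfl)
  calc ∑ q, (latCurl L v q) ^ 2 ≤ ∑ q, 4 * (A q ^ 2 + B q ^ 2 + C q ^ 2 + D q ^ 2) := Finset.sum_le_sum fun q _ => hpt q
    _ = 4 * (∑ q, A q ^ 2 + ∑ q, B q ^ 2 + ∑ q, C q ^ 2 + ∑ q, D q ^ 2) := by
        rw [← Finset.mul_sum, Finset.sum_add_distrib, Finset.sum_add_distrib, Finset.sum_add_distrib]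
    _ ≤ 4 * (6 * ‖v‖ ^ 2 + 6 * ‖v‖ ^ 2 + 6 * ‖v‖ ^ 2 + 6 * ‖v‖ ^ 2) := by gcongr
    _ = 96 * ‖v‖ ^ 2 := by ring

/-- The eigenvalues of `t·H` are `≤ 96t` (`t ≥ 0`). [folklore] -/
theorem smul_stiffHessian_eigenvalues_le {t : ℝ} (ht : 0 ≤ t) (i : Fin (Fintype.card (Edge 3 L × Fin 3))) :
    (isSymmetric_smul_stiffHessian (L := L) t).eigenvalues finrank_euclideanSpace i ≤ 96 * t := by
  set hT := isSymmetric_smul_stiffHessian (L := L) t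
  set e := hT.eigenvectorBasis finrank_euclideanSpace i with he
  set a := hT.eigenvalues finrank_euclideanSpace i with ha
  have hnorm : ‖e‖ = 1 := (hT.eigenvectorBasis finrank_euclideanSpace).orthonormal.1 i
  have happ : (t • stiffHessian L) e = (a : ℝ) • e := hT.apply_eigenvectorBasis finrank_euclideanSpace i
  have h1 : ⟪e, (t • stiffHessian L) e⟫ = a := by
    rw [happ, real_inner_smul_right, real_inner_self_eq_norm_sq, hnorm]; ring
  have h2 : ⟪e, (t • stiffHessian L) e⟫ = t * ‖latCurl L e‖ ^ 2 := by
    rw [LinearMap.smul_apply, real_inner_smul_right, inner_stiffHessian]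
  have h3 := norm_latCurl_sq_le (L := L) e
  rw [hnorm] at h3
  calc a = t * ‖latCurl L e‖ ^ 2 := by rw [← h1, h2]
    _ ≤ t * (96 * 1 ^ 2) := mul_le_mul_of_nonneg_left h3 ht
    _ = 96 * t := by ring

/-- The coefficients of `q_{t,b}` are `≤ 96t + b` (`t ≥ 0`, `b ≥ 0`): `√(a² + 2ab) ≤ a + b`. [folklore] -/
theorem stiffGaussExp_coeff_le {t : ℝ} (ht : 0 ≤ t) {b : ℝ} (hb : 0 ≤ b) (i : Fin (Fintype.card (Edge 3 L × Fin 3))) :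
    Real.sqrt ((isSymmetric_smul_stiffHessian (L := L) t).eigenvalues finrank_euclideanSpace i ^ 2 +
        2 * (isSymmetric_smul_stiffHessian (L := L) t).eigenvalues finrank_euclideanSpace i * b) ≤ 96 * t + b := by
  set a := (isSymmetric_smul_stiffHessian (L := L) t).eigenvalues finrank_euclideanSpace i with ha
  have ha0 : 0 ≤ a := smul_stiffHessian_eigenvalues_nonneg ht i
  have ha96 : a ≤ 96 * t := smul_stiffHessian_eigenvalues_le ht i
  have h1 : Real.sqrt (a ^ 2 + 2 * a * b) ≤ a + b := by
    rw [Real.sqrt_le_left (by positivity)]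
    nlinarith
  linarith

/-! ## §2 Lipschitz control of `q` and its zero modes -/

/-- Parseval in the eigenframe: `Σᵢ ⟪eᵢ, x⟫² = ‖x‖²`. [folklore] -/
theorem sum_sq_inner_eigenvectorBasis (t : ℝ) (x : LinkSpace L) :
    ∑ i, ⟪(isSymmetric_smul_stiffHessian (L := L) t).eigenvectorBasis finrank_euclideanSpace i, x⟫ ^ 2 = ‖x‖ ^ 2 := by
  have h := ((isSymmetric_smul_stiffHessian (L := L) t).eigenvectorBasis finrank_euclideanSpace).sum_inner_mul_inner x x
  rw [real_inner_self_eq_norm_sq] at h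
  rw [← h]
  exact Finset.sum_congr rfl fun i _ => by rw [sq, real_inner_comm]

/-- ★ **Lipschitz control of the stiff exponent**: `|q_{t,b}(x) − q_{t,b}(y)| ≤ (96t + b)·‖x − y‖·‖x + y‖` (`t ≥ 0`, `b ≥ 0`). [folklore] -/
theorem abs_stiffGaussExp_sub_le {t : ℝ} (ht : 0 ≤ t) {b : ℝ} (hb : 0 ≤ b) (x y : LinkSpace L) :
    |stiffGaussExp L t b x - stiffGaussExp L t b y| ≤ (96 * t + b) * ‖x - y‖ * ‖x + y‖ := by
  set hT := isSymmetric_smul_stiffHessian (L := L) t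
  set e := hT.eigenvectorBasis finrank_euclideanSpace with he
  set c : Fin (Fintype.card (Edge 3 L × Fin 3)) → ℝ := fun i => Real.sqrt (hT.eigenvalues finrank_euclideanSpace i ^ 2 + 2 * hT.eigenvalues finrank_euclideanSpace i * b) with hc
  have hc0 : ∀ i, 0 ≤ c i := fun i => Real.sqrt_nonneg _
  have hcle : ∀ i, c i ≤ 96 * t + b := fun i => stiffGaussExp_coeff_le ht hb i
  have hdiff : stiffGaussExp L t b x - stiffGaussExp L t b y = ∑ i, c i * (⟪e i, x - y⟫ * ⟪e i, x + y⟫) := by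
    unfold stiffGaussExp
    rw [← Finset.sum_sub_distrib]
    refine Finset.sum_congr rfl fun i _ => ?_
    rw [inner_sub_right, inner_add_right]; ring
  rw [hdiff]
  have h1 : |∑ i, c i * (⟪e i, x - y⟫ * ⟪e i, x + y⟫)| ≤ ∑ i, (96 * t + b) * (|⟪e i, x - y⟫| * |⟪e i, x + y⟫|) := by
    refine (Finset.abs_sum_le_sum_abs _ _).trans (Finset.sum_le_sum fun i _ => ?_)
    rw [abs_mul, abs_mul, abs_of_nonneg (hc0 i)]
    exact mul_le_mul_of_nonneg_right (hcle i) (by positivity)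
  have h2 : ∑ i, |⟪e i, x - y⟫| * |⟪e i, x + y⟫| ≤ ‖x - y‖ * ‖x + y‖ := by
    have hcs := Finset.sum_mul_sq_le_sq_mul_sq Finset.univ (fun i => |⟪e i, x - y⟫|) (fun i => |⟪e i, x + y⟫|)
    simp only [sq_abs] at hcs
    rw [sum_sq_inner_eigenvectorBasis, sum_sq_inner_eigenvectorBasis] at hcs
    have hS0 : 0 ≤ ∑ i, |⟪e i, x - y⟫| * |⟪e i, x + y⟫| := Finset.sum_nonneg fun i _ => by positivity
    have hP0 : 0 ≤ ‖x - y‖ * ‖x + y‖ := by positivity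
    nlinarith [hcs, hS0, hP0]
  calc _ ≤ ∑ i, (96 * t + b) * (|⟪e i, x - y⟫| * |⟪e i, x + y⟫|) := h1
    _ = (96 * t + b) * ∑ i, |⟪e i, x - y⟫| * |⟪e i, x + y⟫| := by rw [Finset.mul_sum]
    _ ≤ (96 * t + b) * (‖x - y‖ * ‖x + y‖) := mul_le_mul_of_nonneg_left h2 (by positivity)
    _ = (96 * t + b) * ‖x - y‖ * ‖x + y‖ := by ring

/-- ★ **Zero modes are invisible to `q`**: if `(t·H)k = 0` then `q_{t,b}(x + k) = q_{t,b}(x)` (an eigenvector with non-zero eigenvalue is orthogonal to `k`, and a zero eigenvalue carries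
the coefficient `√0 = 0`). In particular pure gauges and constant modes (`…StiffHessian.latCurl_gradient`, `latCurl_constMode`) do not move `q`. [folklore] -/
theorem stiffGaussExp_add_of_ker {t : ℝ} (b : ℝ) {k : LinkSpace L} (hk : (t • stiffHessian L) k = 0) (x : LinkSpace L) :
    stiffGaussExp L t b (x + k) = stiffGaussExp L t b x := by
  set hT := isSymmetric_smul_stiffHessian (L := L) t
  unfold stiffGaussExp
  refine Finset.sum_congr rfl fun i _ => ?_
  set e := hT.eigenvectorBasis finrank_euclideanSpace i with he
  set a := hT.eigenvalues finrank_euclideanSpace i with ha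
  by_cases ha0 : a = 0
  · have : Real.sqrt (a ^ 2 + 2 * a * b) = 0 := by rw [ha0]; simp
    rw [this, zero_mul, zero_mul]
  · have horth : ⟪e, k⟫ = 0 := by
      have h1 : ⟪(t • stiffHessian L) e, k⟫ = ⟪e, (t • stiffHessian L) k⟫ := hT e k
      rw [hk, inner_zero_right, hT.apply_eigenvectorBasis finrank_euclideanSpace i, real_inner_smul_left] at h1
      rcases mul_eq_zero.1 h1 with h | h
      · exact absurd h ha0
      · exact h
    rw [inner_add_right, horth, add_zero]

/-! ## §3 The tube point in the chart -/

/-- ★ **The gnomonic chart inverts `gnLink` on the open upper hemisphere**: `P(gn U) = U` for `scalarPart U > 0`. [folklore] -/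
theorem gnoPoint_gnLink (U : SU2) (h : 0 < scalarPart U) : gnoPoint (gnLink U) = U := by
  have hq : gnomonicQuat (gnLink U) = (scalarPart U)⁻¹ • su2Quat U := by
    have hs : (scalarPart U)⁻¹ * scalarPart U = 1 := inv_mul_cancel₀ h.ne'
    ext
    · simpa [gnomonicQuat, scalarPart] using hs.symm
    · simp [gnomonicQuat, gnLink_apply, vecPart, scalarPart, div_eq_inv_mul]
    · simp [gnomonicQuat, gnLink_apply, vecPart, scalarPart, div_eq_inv_mul]
    · simp [gnomonicQuat, gnLink_apply, vecPart, scalarPart, div_eq_inv_mul]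
  unfold gnoPoint
  rw [hq, quatToSU2_smul (inv_pos.2 h), quatToSU2_su2Quat]

omit [NeZero L] in
/-- A configuration with every link in the open upper hemisphere is the chart point of its gnomonic coordinates. [folklore] -/
theorem latPatternChart_gnLink (U : GaugeConfig 3 L SU2) (h : ∀ e, 0 < scalarPart (U e)) : latPatternChart L (fun _ => false) (fun e => gnLink (U e)) = U := by
  funext e
  rw [latPatternChart_false]
  exact gnoPoint_gnLink (U e) (h e)

/-- On the cap `Σ_a v_a² ≤ 1/4`: `scalarPart (chartSU2 v) = √(1 − |v|²) ≥ 1/2`, in particular positive. [folklore] -/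
theorem scalarPart_chartSU2_ge_half {v : Fin 3 → ℝ} (hv : ∑ a, v a ^ 2 ≤ 1 / 4) : 1 / 2 ≤ scalarPart (chartSU2 v) := by
  rw [scalarPart_chartSU2 (hv.trans (by norm_num))]
  have h : Real.sqrt (1 / 4 : ℝ) = 1 / 2 := by
    rw [show (1 / 4 : ℝ) = (1 / 2) ^ 2 by norm_num]; exact Real.sqrt_sq (by norm_num)
  rw [← h]
  exact Real.sqrt_le_sqrt (by linarith)

omit [NeZero L] in
/-- ★ **The central tube point is a chart point**: `orthoTube L 1 v' = P(w')` with `w'_e = gn(chartSU2 v'_e)`, for `v'` on the cap. [folklore] -/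
theorem orthoTube_one_eq_latPatternChart {v' : Edge 3 L → Fin 3 → ℝ} (hv' : ∀ e, ∑ a, v' e a ^ 2 ≤ 1 / 4) :
    orthoTube L 1 v' = latPatternChart L (fun _ => false) (fun e => gnLink (chartSU2 (v' e))) := by
  have h1 : orthoTube L 1 v' = fun e => chartSU2 (v' e) := by
    funext e; rw [orthoTube_apply, Pi.one_apply, mul_one]
  rw [h1]
  exact (latPatternChart_gnLink (L := L) (fun e => chartSU2 (v' e)) fun e => lt_of_lt_of_le (by norm_num) (scalarPart_chartSU2_ge_half (hv' e))).symm

/-- The gnomonic coordinates of `chartSU2 v`: `gn(chartSU2 v)_a = v_a / √(1 − |v|²)` on the cap. [folklore] -/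
theorem gnLink_chartSU2 {v : Fin 3 → ℝ} (hv : ∑ a, v a ^ 2 ≤ 1 / 4) (a : Fin 3) : gnLink (chartSU2 v) a = v a / scalarPart (chartSU2 v) := by
  rw [gnLink_apply, vecPart_chartSU2 (hv.trans (by norm_num))]

/-- Ball bound for the chart coordinates of a cap point: `Σ_a gn(chartSU2 v)_a² ≤ (4/3)·Σ_a v_a²` (`Σ_a v_a² ≤ 1/4`). [folklore] -/
theorem sum_gnLink_chartSU2_sq_le {v : Fin 3 → ℝ} (hv : ∑ a, v a ^ 2 ≤ 1 / 4) : ∑ a, gnLink (chartSU2 v) a ^ 2 ≤ 4 / 3 * ∑ a, v a ^ 2 := by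
  set s := scalarPart (chartSU2 v) with hs
  have hs2 : s ^ 2 = 1 - ∑ a, v a ^ 2 := by
    rw [hs, scalarPart_chartSU2 (hv.trans (by norm_num)), Real.sq_sqrt (by linarith)]
  have hs0 : 1 / 2 ≤ s := scalarPart_chartSU2_ge_half hv
  have hsum : ∑ a, gnLink (chartSU2 v) a ^ 2 = (∑ a, v a ^ 2) / s ^ 2 := by
    rw [Finset.sum_div]; exact Finset.sum_congr rfl fun a _ => by rw [gnLink_chartSU2 hv, div_pow]
  rw [hsum, div_le_iff₀ (by positivity)]
  have h0 : 0 ≤ ∑ a, v a ^ 2 := Finset.sum_nonneg fun a _ => sq_nonneg _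
  nlinarith

/-- Distance bound for one link: `|gn(chartSU2 v)_a − v_a| ≤ 2·|v_a|·Σ_b v_b²` on the cap (`1 − s ≤ |v|²`, `1/s ≤ 2`). [folklore] -/
theorem abs_gnLink_chartSU2_sub_le {v : Fin 3 → ℝ} (hv : ∑ a, v a ^ 2 ≤ 1 / 4) (a : Fin 3) :
    |gnLink (chartSU2 v) a - v a| ≤ 2 * |v a| * ∑ b, v b ^ 2 := by
  set s := scalarPart (chartSU2 v) with hs
  set X := ∑ b, v b ^ 2 with hX
  have hX0 : 0 ≤ X := Finset.sum_nonneg fun b _ => sq_nonneg _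
  have hs2 : s ^ 2 = 1 - X := by
    rw [hs, scalarPart_chartSU2 (hv.trans (by norm_num)), Real.sq_sqrt (by linarith)]
  have hs0 : 1 / 2 ≤ s := scalarPart_chartSU2_ge_half hv
  have hs1 : s ≤ 1 := by nlinarith
  have h1s : 1 - s ≤ X := by nlinarith
  rw [gnLink_chartSU2 hv]
  have heq : v a / s - v a = v a * ((1 - s) / s) := by
    have hs' : s ≠ 0 := by linarith
    field_simp
  rw [heq, abs_mul, abs_div, abs_of_nonneg (by linarith : 0 ≤ 1 - s), abs_of_pos (by linarith : 0 < s)]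
  have h2 : (1 - s) / s ≤ 2 * X := by rw [div_le_iff₀ (by linarith)]; nlinarith
  calc |v a| * ((1 - s) / s) ≤ |v a| * (2 * X) := mul_le_mul_of_nonneg_left h2 (abs_nonneg _)
    _ = 2 * |v a| * X := by ring

omit [NeZero L] in
/-- `chartVec` is `linkEmbed`. [folklore] -/
theorem chartVec_eq_linkEmbed (w : Edge 3 L → Fin 3 → ℝ) : chartVec w = linkEmbed L w := rfl

/-- ★ **The chart centre is close to the tube coordinate**: for `Σ_a v'_e a² ≤ τ² ≤ 1/4` on every link,
`‖chartVec (gn ∘ chartSU2 ∘ v') − linkEmbed v'‖ ≤ 2τ²·‖linkEmbed v'‖`. [folklore] -/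
theorem norm_chartVec_gnLink_sub_linkEmbed_le {v' : Edge 3 L → Fin 3 → ℝ} {τ : ℝ} (hτ : τ ^ 2 ≤ 1 / 4) (hv' : ∀ e, ∑ a, v' e a ^ 2 ≤ τ ^ 2) :
    ‖chartVec (fun e => gnLink (chartSU2 (v' e))) - linkEmbed L v'‖ ≤ 2 * τ ^ 2 * ‖linkEmbed L v'‖ := by
  have hcap : ∀ e, ∑ a, v' e a ^ 2 ≤ 1 / 4 := fun e => (hv' e).trans hτ
  have hτ0 : 0 ≤ τ ^ 2 := le_trans (Finset.sum_nonneg fun a _ => sq_nonneg _) (hv' (default : Edge 3 L))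
  -- squared components
  have hsq : ‖chartVec (fun e => gnLink (chartSU2 (v' e))) - linkEmbed L v'‖ ^ 2 ≤ (2 * τ ^ 2) ^ 2 * ‖linkEmbed L v'‖ ^ 2 := by
    rw [EuclideanSpace.norm_sq_eq, EuclideanSpace.norm_sq_eq, Finset.mul_sum]
    refine Finset.sum_le_sum fun ea _ => ?_
    obtain ⟨e, a⟩ := ea
    simp only [PiLp.sub_apply, chartVec_apply, linkEmbed_apply, Real.norm_eq_abs, sq_abs]
    have h1 := abs_gnLink_chartSU2_sub_le (hcap e) a
    have h2 : 2 * |v' e a| * ∑ b, v' e b ^ 2 ≤ 2 * τ ^ 2 * |v' e a| := by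
      have := mul_le_mul_of_nonneg_left (hv' e) (by positivity : 0 ≤ 2 * |v' e a|); linarith
    have h3 : |gnLink (chartSU2 (v' e)) a - v' e a| ≤ 2 * τ ^ 2 * |v' e a| := h1.trans h2
    have h4 := pow_le_pow_left₀ (abs_nonneg _) h3 2
    rw [sq_abs, mul_pow, sq_abs] at h4
    exact h4
  have h0 : 0 ≤ 2 * τ ^ 2 * ‖linkEmbed L v'‖ := by positivity
  rw [← mul_pow] at hsq
  exact (pow_le_pow_iff_left₀ (norm_nonneg _) h0 two_ne_zero).1 hsq

/-! ## §4 The stiff exponent at the chart centre against the tube coordinate -/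

/-- ★★ **`q` at the chart centre vs at the tube coordinate**: for `t, b ≥ 0`, `Σ_a v'_e a² ≤ τ² ≤ 1/4` on every link and `‖linkEmbed v'‖ ≤ R`,
`|q_{t,b}(chartVec (gn ∘ chartSU2 ∘ v')) − q_{t,b}(linkEmbed v')| ≤ 6(96t + b)·τ²·R²`. [folklore] -/
theorem abs_stiffGaussExp_chart_sub_tube_le {t : ℝ} (ht : 0 ≤ t) {b : ℝ} (hb : 0 ≤ b) {v' : Edge 3 L → Fin 3 → ℝ} {τ R : ℝ} (hτ : τ ^ 2 ≤ 1 / 4)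
    (hv' : ∀ e, ∑ a, v' e a ^ 2 ≤ τ ^ 2) (hR : ‖linkEmbed L v'‖ ≤ R) :
    |stiffGaussExp L t b (chartVec (fun e => gnLink (chartSU2 (v' e)))) - stiffGaussExp L t b (linkEmbed L v')| ≤ 6 * (96 * t + b) * τ ^ 2 * R ^ 2 := by
  set x := chartVec (fun e => gnLink (chartSU2 (v' e))) with hx
  set x' := linkEmbed L v' with hx'
  have hτ0 : 0 ≤ τ ^ 2 := le_trans (Finset.sum_nonneg fun a _ => sq_nonneg _) (hv' (default : Edge 3 L))
  have hR0 : 0 ≤ R := (norm_nonneg _).trans hR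
  have hδ : ‖x - x'‖ ≤ 2 * τ ^ 2 * R := (norm_chartVec_gnLink_sub_linkEmbed_le hτ hv').trans (mul_le_mul_of_nonneg_left hR (by positivity))
  have hsum : ‖x + x'‖ ≤ 3 * R := by
    have h1 : x + x' = (x - x') + (2 : ℝ) • x' := by rw [two_smul]; abel
    rw [h1]
    calc ‖(x - x') + (2 : ℝ) • x'‖ ≤ ‖x - x'‖ + ‖(2 : ℝ) • x'‖ := norm_add_le _ _
      _ ≤ 2 * τ ^ 2 * R + 2 * R := by rw [norm_smul, Real.norm_two]; linarith [mul_le_mul_of_nonneg_left hR (by norm_num : (0 : ℝ) ≤ 2)]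
      _ ≤ 3 * R := by nlinarith
  calc _ ≤ (96 * t + b) * ‖x - x'‖ * ‖x + x'‖ := abs_stiffGaussExp_sub_le ht hb x x'
    _ ≤ (96 * t + b) * (2 * τ ^ 2 * R) * (3 * R) := by gcongr
    _ = 6 * (96 * t + b) * τ ^ 2 * R ^ 2 := by ring

end Summit.QuantumFields.YangMills.Theorems.FemtoTransferGap.TwoLattice.ConstTube

end
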